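import Literature.AlgebraicGeometry.AbelianSchemes.AbelianSchemeFibreBaseChangeHom
import Literature.AlgebraicGeometry.AbelianSchemes.AbelianSchemeFibreFrobeniusTwistHom
import Literature.AlgebraicGeometry.Motives.IntegralModelReductionMap
import HarnessLib

/-!
# The fibre tuple of an abelian scheme along an integral point: «reduction of points = reduction of tuples»
# ([SerreTate1968] §1 «the reduction map»; [MumfordFogartyKirwan1994] Ch. 7 §2 Def. 7.2; [GortzWedhorn2020] (4.7))

Topic `AlgebraicGeometry/AbelianSchemes`; namespaces `Literature.AlgebraicGeometry.AbelianSchemes.AbelianSchemeOver` (§1, §3)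
and `Literature.AlgebraicGeometry.Motives.IntegralModel` (§2).  KERNEL ONLY: theorems; **no definition, no named fact, no
instance, no notation, no `sorry`**.  Cell `pub/hodgecm-mathlib`, programme P6 («MOD»), piece (d5) of the (d1)–(d4) lineage
(desk F0P6c-plan (g0) «= (d5) NOW», 2026-09-01): the BRIDGE between the pointwise dictionary's reduction map on POINTS
(`red := red_𝓨 ∘ ℓ_e`, ★ `IntegralModel.geomReductionMap`) and the abelian schemes over the VALUATION RING of the point on
which the (c2) letters `red_quotΩ` ∕ `red_translΩ` run (★ (o-c2f) extension of isogenies, (o-c2g) closure of kernels,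
(o-c2l) reduction on kernels, (o-c3h) ∕ ★ `RelFrobeniusFactorIso` on the special fibre).

## Mathematics

§1 (any base).  Let `𝒜 → T` be an abelian scheme, `j : U → T` and `x̃ : V → T` two morphisms (think: `U` = the generic or
the special fibre of a model `T`, `V = Spec R` an integral point), and `y : Spec L → U`, `u : Spec L → V` field-valued
points with `y ≫ j = u ≫ x̃`.  Then the restricted families `𝒜|_U := 𝒜 ×_T U` and `𝒜_x̃ := 𝒜 ×_T V` have THE SAME fibre
tuple at `y` and `u`: `(𝒜|_U)_y ≅ 𝒜_{y ≫ j} = 𝒜_{u ≫ x̃} ≅ (𝒜_x̃)_u` (★ `fibreBaseChangeIso` twice and ★ `fibreCongrPtIso`),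
compatibly with every homomorphism `f : 𝒜 → ℬ` of abelian schemes over `T` (★ (d4) `fibreHom_baseChangeHom_comp_fibreBaseChangeIso_hom`,
★ (d2) `fibreHom_comp_fibreCongrPtIso_hom`) and with the pulled-back sections (★ `map_fibreBaseChangeIso_restrictPt_sectionBaseChange`,
★ (d1) `map_fibreCongrPtIso_restrictPt`) — `exists_iso_fibre_baseChange_of_comp_eq`.

§2 (the point equalities of a proper model `𝓨` of `Y` at `v`, `R = closureValuationSubring (v.adicCompletion K) ⊆ Ω = \overline{K_v}`).
For `x ∈ Y(Ω)` let `x̃ := extendPoint R _ 𝓨.total (𝓨.modelPointsEquiv.symm x) : Spec R → 𝓨` be its `R`-point (valuative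
criterion).  Then
* `(𝓨.modelPointsEquiv.symm x).left = x ≫ ι_η` with `ι_η := 𝓨.genericIso'⁻¹ ≫ pr₁ : Y → 𝓨` the generic-fibre inclusion
  (`left_modelPointsEquiv_symm`), and `η_R ≫ x̃ = (𝓨.modelPointsEquiv.symm x).left` (`left_specFractionFieldι_comp_extendPoint`, ANY `R`);
* `(red_𝓨 x).left ≫ ι_s = c ≫ s_R ≫ x̃` with `ι_s := pr₁ : 𝓨_s → 𝓨` the special-fibre inclusion, `s_R : Spec κ(R) → Spec R` the
  closed point and `c : Spec κ̄(v) ≅ Spec κ(R)` the rebase of ★ `geomClosedPointIsoSpecResidueField`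
  (`left_geomReductionMap_comp_fst`; general form `left_reductionPoint_comp_fst` for ANY `κ(R)`-point).

§3 (assembly).  For an abelian scheme `𝒜 → 𝓨` (the universal family over the MODEL): the fibre tuple of `𝒜|_Y` at `x` IS the
GENERIC fibre tuple of `𝒜_x̃ → Spec R`, and the fibre tuple of `𝒜|_{𝓨_s}` at `red_𝓨 x` IS the SPECIAL fibre tuple of `𝒜_x̃`
(at `c ≫ s_R`) — `exists_iso_fibre_generic_along_extendPoint`, `exists_iso_fibre_special_along_extendPoint`; i.e. «reduction of
points = reduction of tuples» [SerreTate1968, §1].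

HC_CM is proved only modulo the printed citations until rung 0 closes; this file changes no count.

## References
* [SerreTate1968] J.-P. Serre, J. Tate, *Good reduction of abelian varieties*, Ann. of Math. 88 (1968), §1 (the reduction map).
* [MumfordFogartyKirwan1994] D. Mumford, J. Fogarty, F. Kirwan, *GIT* (3rd ed.), Ch. 7 §2 Def. 7.2 (p. 129) (base change of the
  moduli datum), Ch. 6 §2 Def. 6.3 (p. 120).
* [GortzWedhorn2020] U. Görtz, T. Wedhorn, *Algebraic Geometry I* (2nd ed.), Section (4.7) (p. 135), Prop. 4.16.
* [Hartshorne1977] R. Hartshorne, *Algebraic Geometry*, II.4.7 (valuative criterion), II.3 Thm. 3.3.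
-/

set_option autoImplicit false

noncomputable section

-- `(specOver K Ω).left = Spec Ω`, `(Over.mk f).left` etc. are definitional only above `instances` transparency (as in ★ (d1)–(d4)).
set_option backward.isDefEq.respectTransparency false

universe u

open CategoryTheory CategoryTheory.Limits AlgebraicGeometry

/-! ## §1 Two restricted families share a fibre tuple -/

namespace Literature.AlgebraicGeometry.AbelianSchemes

namespace AbelianSchemeOver

open Literature.AlgebraicGeometry.Motives
open scoped MonObj

section Share

variable {T U V : Scheme.{u}} (j : U ⟶ T) (xt : V ⟶ T) {L : Type u} [Field L] {y : Spec (.of L) ⟶ U}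
  {u : Spec (.of L) ⟶ V}

/-- For an isomorphism `φ : X ≅ Y` of abelian varieties: if `φ` carries `P` to `Q` then `φ⁻¹` carries `Q` to `P`.
[cite: GortzWedhorn2020, Section (4.7) (p. 135)] -/
private theorem map_inv_eq_of_map_hom_eq_int {K : Type u} [Field K] {X Y : AbelianVariety K} (φ : X ≅ Y) {Ω : Type u} [Field Ω]
    [Algebra K Ω] {P : AlgPoints X.X Ω} {Q : AlgPoints Y.X Ω} (hPQ : AlgPoints.map φ.hom.hom.hom.hom P = Q) :
    AlgPoints.map φ.inv.hom.hom.hom Q = P := by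
  rw [← hPQ]
  change (P ≫ φ.hom.hom.hom.hom) ≫ φ.inv.hom.hom.hom = P
  have hφ : φ.hom.hom.hom.hom ≫ φ.inv.hom.hom.hom = 𝟙 _ := congrArg (fun ψ => ψ.hom.hom.hom) φ.hom_inv_id
  rw [Category.assoc, hφ, Category.comp_id]

/-- **Two restricted families share a fibre tuple.**  For an abelian scheme `𝒜 → T`, morphisms `j : U → T`, `x̃ : V → T` and
field-valued points `y` of `U`, `u` of `V` over the same point of `T` (`y ≫ j = u ≫ x̃`), there is ONE family of isomorphisms
`e_𝒜 : (𝒜 ×_T U)_y ≅ (𝒜 ×_T V)_u`, indexed by the abelian schemes over `T`, (i) carrying the value at `y` of every pulled-back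
section `τ ×_T U` to the value at `u` of `τ ×_T V` and (ii) natural in `𝒜` for homomorphisms `f : 𝒜 → ℬ` over `T`
(`(f ×_T U)_y ≫ e_ℬ = e_𝒜 ≫ (f ×_T V)_u`): the tuple `(𝒜|_U, ι|_U, λ|_U, η|_U)` at `y` IS the tuple `(𝒜|_V, …)` at `u`
(`e_𝒜 = ` ★ `fibreBaseChangeIso` ≫ ★ `fibreCongrPtIso` ≫ ★ `fibreBaseChangeIso⁻¹`).
[cite: MumfordFogartyKirwan1994, Ch. 7 §2 Definition 7.2 (p. 129)] [cite: GortzWedhorn2020, Section (4.7) (p. 135), Prop. 4.16] -/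
theorem exists_iso_fibre_baseChange_of_comp_eq (h : y ≫ j = u ≫ xt) :
    ∃ e : ∀ 𝒜 : AbelianSchemeOver T,
        ((𝒜.baseChange j).fibre y).toAbelianVariety ≅ ((𝒜.baseChange xt).fibre u).toAbelianVariety,
      (∀ (𝒜 : AbelianSchemeOver T) (τ : 𝒜.Sections),
          AlgPoints.map (e 𝒜).hom.hom.hom.hom ((𝒜.baseChange j).restrictPt y (𝒜.sectionBaseChange j τ)) =
            (𝒜.baseChange xt).restrictPt u (𝒜.sectionBaseChange xt τ)) ∧
      ∀ (𝒜 ℬ : AbelianSchemeOver T) (f : 𝒜.X ⟶ ℬ.X) [IsMonHom f],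
        (haveI := isMonHom_baseChangeHom f j
         haveI := isMonHom_baseChangeHom f xt
         fibreHom (baseChangeHom f j) y ≫ (e ℬ).hom = (e 𝒜).hom ≫ fibreHom (baseChangeHom f xt) u) := by
  refine ⟨fun 𝒜 => 𝒜.fibreBaseChangeIso j y ≪≫ 𝒜.fibreCongrPtIso h ≪≫ (𝒜.fibreBaseChangeIso xt u).symm,
    fun 𝒜 τ => ?_, fun 𝒜 ℬ f _ => ?_⟩
  · have h3 : AlgPoints.map (𝒜.fibreBaseChangeIso xt u).inv.hom.hom.hom (𝒜.restrictPt (u ≫ xt) τ) =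
        (𝒜.baseChange xt).restrictPt u (𝒜.sectionBaseChange xt τ) :=
      map_inv_eq_of_map_hom_eq_int (𝒜.fibreBaseChangeIso xt u) (𝒜.map_fibreBaseChangeIso_restrictPt_sectionBaseChange xt u τ)
    calc AlgPoints.map (𝒜.fibreBaseChangeIso j y ≪≫ 𝒜.fibreCongrPtIso h ≪≫ (𝒜.fibreBaseChangeIso xt u).symm).hom.hom.hom.hom
          ((𝒜.baseChange j).restrictPt y (𝒜.sectionBaseChange j τ))
        = AlgPoints.map (𝒜.fibreBaseChangeIso xt u).inv.hom.hom.hom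
            (AlgPoints.map (𝒜.fibreCongrPtIso h).hom.hom.hom.hom
              (AlgPoints.map (𝒜.fibreBaseChangeIso j y).hom.hom.hom.hom
                ((𝒜.baseChange j).restrictPt y (𝒜.sectionBaseChange j τ)))) := by
            simp only [AlgPoints.map_apply, Iso.trans_hom, Iso.symm_hom, AbelianVariety.comp_hom, Category.assoc]
            rfl
      _ = (𝒜.baseChange xt).restrictPt u (𝒜.sectionBaseChange xt τ) := by
            rw [𝒜.map_fibreBaseChangeIso_restrictPt_sectionBaseChange j y τ, 𝒜.map_fibreCongrPtIso_restrictPt h τ, h3]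
  · haveI := isMonHom_baseChangeHom f j
    haveI := isMonHom_baseChangeHom f xt
    simp only [Iso.trans_hom, Iso.symm_hom]
    rw [← Category.assoc, fibreHom_baseChangeHom_comp_fibreBaseChangeIso_hom, Category.assoc, ← Category.assoc (fibreHom f _),
      fibreHom_comp_fibreCongrPtIso_hom, Category.assoc, fibreHom_comp_fibreBaseChangeIso_inv, Category.assoc, Category.assoc]

end Share

end AbelianSchemeOver

end Literature.AlgebraicGeometry.AbelianSchemes

/-! ## §2 The point equalities of a proper integral model -/

namespace Literature.AlgebraicGeometry.Motives

open IsDedekindDomain IsDedekindDomain.HeightOneSpectrum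
open scoped NumberField
open Literature.NumberTheory.EllipticCurves (genericFibre specGenericPoint)
open Literature.NumberTheory.GaloisRepresentations (closureValuationSubring)
open Literature.NumberTheory.DiophantineGeometry

section AnyValuationRing

variable {O : Type u} [CommRing O] {Ω : Type u} [Field Ω] (R : ValuationSubring Ω) (f : O →+* R) (𝒳 : SchemeOver O)

/-- **Generic point of the extension (ANY valuation ring `R ⊆ Ω`, any `O → R`)**: the `R`-point `x̃ = extendPoint P` of a proper
`O`-scheme restricts at the generic point `η_R : Spec Ω → Spec R` to `P`: `η_R ≫ x̃ = P` on underlying schemes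
(★ `restrictPoint_extendPoint`). [cite: Hartshorne1977, II.4.7] -/
theorem left_specFractionFieldι_comp_extendPoint [IsProper 𝒳.hom] (P : specFractionField R f ⟶ 𝒳) :
    (specFractionFieldι R f).left ≫ (extendPoint R f 𝒳 P).left = P.left := by
  rw [← Over.comp_left]
  exact congrArg (fun φ => φ.left) (restrictPoint_extendPoint R f 𝒳 P)

end AnyValuationRing

namespace IntegralModel

variable {K : Type} [Field K] [NumberField K] {v : HeightOneSpectrum (𝓞 K)} {Y : SchemeOver K}
  (𝓨 : IntegralModel (valuationSubringAtPrime K v) K Y)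

/-- The rebase isomorphism `Spec Ω ≅ (Spec Ω viewed over 𝓞ᵥ through K)` (★ `specFractionFieldIso`) is the identity on underlying
schemes. [cite: Hartshorne1977, II.3 Thm. 3.3] -/
theorem specFractionFieldIso_inv_left : (specFractionFieldIso v).inv.left = 𝟙 _ := rfl

/-- The rebase isomorphism `geomClosedPoint v ≅ Over.map (Spec κ̄(v))` (★ `geomClosedPointIso`) is the identity on underlying schemes.
[cite: Hartshorne1977, II.3 Thm. 3.3] -/
theorem geomClosedPointIso_inv_left : (geomClosedPointIso v).inv.left = 𝟙 _ := rfl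

/-- **The `Ω`-point of the model under `modelPointsEquiv⁻¹`, read in the total space**: for `x ∈ Y(Ω)`,
`(𝓨.modelPointsEquiv.symm x).left = x ≫ ι_η` with `ι_η := 𝓨.genericIso'⁻¹ ≫ pr₁ : Y → 𝓨 ×_{𝓞ᵥ} K → 𝓨` the inclusion of the generic
fibre read on `Y` (adjunction `Over.map ⊣ Over.pullback`). [cite: Hartshorne1977, II.3 Thm. 3.3] -/
theorem left_modelPointsEquiv_symm (x : AlgPoints Y (AlgebraicClosure (v.adicCompletion K))) :
    (𝓨.modelPointsEquiv.symm x).left =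
      x.left ≫ 𝓨.genericIso'.inv.left ≫ pullback.fst 𝓨.total.hom (specGenericPoint (valuationSubringAtPrime K v) K) := by
  set P := 𝓨.modelPointsEquiv.symm x with hP
  have hx : 𝓨.modelPointsEquiv P = x := Equiv.apply_symm_apply _ x
  rw [modelPointsEquiv_apply] at hx
  have h2 : (Over.mapPullbackAdj (specGenericPoint (valuationSubringAtPrime K v) K)).homEquiv _ 𝓨.total
      ((specFractionFieldIso v).inv ≫ P) = x ≫ 𝓨.genericIso'.inv := by
    rw [← hx, Category.assoc, Iso.hom_inv_id, Category.comp_id]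
  have h3 : (specFractionFieldIso v).inv ≫ P =
      ((Over.mapPullbackAdj (specGenericPoint (valuationSubringAtPrime K v) K)).homEquiv _ 𝓨.total).symm (x ≫ 𝓨.genericIso'.inv) := by
    rw [← h2, Equiv.symm_apply_apply]
  have h4 := congrArg (fun φ => φ.left) h3
  simp only [Over.comp_left, specFractionFieldIso_inv_left, Category.id_comp] at h4
  rw [h4]
  rfl

/-- **Generic point equality**: `η_R ≫ x̃ = x ≫ ι_η` for the `R`-point `x̃ := extendPoint (modelPointsEquiv⁻¹ x)` of the proper model.
[cite: Hartshorne1977, II.4.7] [cite: SerreTate1968, §1] -/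
theorem left_specFractionFieldι_comp_extendPoint_modelPointsEquiv_symm [IsProper 𝓨.total.hom]
    (x : AlgPoints Y (AlgebraicClosure (v.adicCompletion K))) :
    (specFractionFieldι (closureValuationSubring (v.adicCompletion K)) (toClosureValuationSubring v)).left ≫
        (extendPoint (closureValuationSubring (v.adicCompletion K)) (toClosureValuationSubring v) 𝓨.total
          (𝓨.modelPointsEquiv.symm x)).left =
      x.left ≫ 𝓨.genericIso'.inv.left ≫ pullback.fst 𝓨.total.hom (specGenericPoint (valuationSubringAtPrime K v) K) := by
  rw [left_specFractionFieldι_comp_extendPoint, left_modelPointsEquiv_symm]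

/-- **Special point equality (ANY `κ(R)`-point)**: the `κ̄(v)`-point `𝓨.reductionPoint y` of the special fibre `𝓨_s = 𝓨 ×_{𝓞ᵥ} κ(v)`, followed
by the inclusion `ι_s = pr₁ : 𝓨_s → 𝓨`, is `c ≫ y` with `c : Spec κ̄(v) → Spec κ(R)` the rebase of ★ `geomClosedPointIsoSpecResidueField`
(adjunction `Over.map ⊣ Over.pullback` at the closed point). [cite: Hartshorne1977, II.3 Thm. 3.3] [cite: SerreTate1968, §1] -/
theorem left_reductionPoint_comp_fst (y : residueFieldPoints 𝓨.total) :
    (𝓨.reductionPoint y).left ≫ pullback.fst 𝓨.total.hom (specResidueField v) =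
      (geomClosedPointIsoSpecResidueField v).inv.left ≫ y.left := by
  have h1 : ((Over.mapPullbackAdj (specResidueField v)).homEquiv _ 𝓨.total).symm (𝓨.reductionPoint y) =
      (geomClosedPointIso v).inv ≫ (geomClosedPointIsoSpecResidueField v).inv ≫ y := by
    rw [reductionPoint, Equiv.symm_apply_apply]
  have h2 := congrArg (fun φ => φ.left) h1
  simp only [Over.comp_left, geomClosedPointIso_inv_left, Category.id_comp] at h2
  rw [← h2]
  rfl

/-- **Special point equality for the reduction map**: `(red_𝓨 x) ≫ ι_s = c ≫ s_R ≫ x̃` — the reduction of `x` IS the closed point of the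
`R`-point `x̃ = extendPoint (modelPointsEquiv⁻¹ x)` extending it (★ `geomReductionMap_def`). [cite: SerreTate1968, §1] [cite: Hartshorne1977, II.4.7] -/
theorem left_geomReductionMap_comp_fst [IsProper 𝓨.total.hom] (x : AlgPoints Y (AlgebraicClosure (v.adicCompletion K))) :
    (𝓨.geomReductionMap x).left ≫ pullback.fst 𝓨.total.hom (specResidueField v) =
      (geomClosedPointIsoSpecResidueField v).inv.left ≫
        (specRingHomι (closureValuationSubring (v.adicCompletion K)) (toClosureValuationSubring v)
            (IsLocalRing.residue (closureValuationSubring (v.adicCompletion K)))).left ≫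
          (extendPoint (closureValuationSubring (v.adicCompletion K)) (toClosureValuationSubring v) 𝓨.total
            (𝓨.modelPointsEquiv.symm x)).left := by
  rw [geomReductionMap_def, left_reductionPoint_comp_fst, Over.comp_left]

end IntegralModel

end Literature.AlgebraicGeometry.Motives

/-! ## §3 Assembly: the fibre tuple at `x` and at `red_𝓨 x` are the generic and special fibre tuples of `𝒜_x̃ → Spec R` -/

namespace Literature.AlgebraicGeometry.AbelianSchemes

namespace AbelianSchemeOver

open Literature.AlgebraicGeometry.Motives IsDedekindDomain IsDedekindDomain.HeightOneSpectrum
open scoped NumberField MonObj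
open Literature.NumberTheory.EllipticCurves (genericFibre specGenericPoint)
open Literature.NumberTheory.GaloisRepresentations (closureValuationSubring)
open Literature.NumberTheory.DiophantineGeometry

variable {K : Type} [Field K] [NumberField K] {v : HeightOneSpectrum (𝓞 K)} {Y : SchemeOver K}
  (𝓨 : IntegralModel (valuationSubringAtPrime K v) K Y) [IsProper 𝓨.total.hom]
  (x : AlgPoints Y (AlgebraicClosure (v.adicCompletion K)))

/-- **The fibre tuple at `x` is the GENERIC fibre tuple of `𝒜_x̃`.**  For an abelian scheme `𝒜 → 𝓨` over (the total space of) a proper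
model and `x ∈ Y(Ω)` with `R`-point `x̃ = extendPoint (modelPointsEquiv⁻¹ x)`: ONE family of isomorphisms between the fibre at `x` of the
generic family `𝒜|_Y := 𝒜 ×_𝓨 Y` (along `ι_η = genericIso'⁻¹ ≫ pr₁`) and the fibre at the generic point `η_R` of `𝒜_x̃ := 𝒜 ×_𝓨 Spec R`,
natural in `𝒜` (homomorphisms `ι(a)`, `λ`) and carrying pulled-back sections to pulled-back sections.
[cite: SerreTate1968, §1] [cite: MumfordFogartyKirwan1994, Ch. 7 §2 Definition 7.2 (p. 129)] -/
theorem exists_iso_fibre_generic_along_extendPoint :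
    ∃ e : ∀ 𝒜 : AbelianSchemeOver 𝓨.total.left,
        ((𝒜.baseChange (𝓨.genericIso'.inv.left ≫ pullback.fst 𝓨.total.hom (specGenericPoint (valuationSubringAtPrime K v) K))).fibre
            x.left).toAbelianVariety ≅
          ((𝒜.baseChange (extendPoint (closureValuationSubring (v.adicCompletion K)) (toClosureValuationSubring v) 𝓨.total
              (𝓨.modelPointsEquiv.symm x)).left).fibre
            (specFractionFieldι (closureValuationSubring (v.adicCompletion K)) (toClosureValuationSubring v)).left).toAbelianVariety,
      (∀ (𝒜 : AbelianSchemeOver 𝓨.total.left) (τ : 𝒜.Sections),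
          AlgPoints.map (e 𝒜).hom.hom.hom.hom
              ((𝒜.baseChange _).restrictPt x.left (𝒜.sectionBaseChange _ τ)) =
            (𝒜.baseChange _).restrictPt _ (𝒜.sectionBaseChange _ τ)) ∧
      ∀ (𝒜 ℬ : AbelianSchemeOver 𝓨.total.left) (f : 𝒜.X ⟶ ℬ.X) [IsMonHom f],
        (haveI := isMonHom_baseChangeHom f
           (𝓨.genericIso'.inv.left ≫ pullback.fst 𝓨.total.hom (specGenericPoint (valuationSubringAtPrime K v) K))
         haveI := isMonHom_baseChangeHom f
           (extendPoint (closureValuationSubring (v.adicCompletion K)) (toClosureValuationSubring v) 𝓨.total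
              (𝓨.modelPointsEquiv.symm x)).left
         fibreHom (baseChangeHom f _) x.left ≫ (e ℬ).hom = (e 𝒜).hom ≫ fibreHom (baseChangeHom f _) _) :=
  exists_iso_fibre_baseChange_of_comp_eq _ _
    (by rw [𝓨.left_specFractionFieldι_comp_extendPoint_modelPointsEquiv_symm x])

/-- **The fibre tuple at `red_𝓨 x` is the SPECIAL fibre tuple of `𝒜_x̃`.**  Same data; ONE family of isomorphisms between the fibre at
the reduction `red_𝓨 x ∈ 𝓨_s(κ̄(v))` of the special family `𝒜|_{𝓨_s} := 𝒜 ×_𝓨 𝓨_s` (along `ι_s = pr₁`) and the fibre of `𝒜_x̃ → Spec R` at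
its geometric closed point `c ≫ s_R : Spec κ̄(v) → Spec κ(R) → Spec R`, natural in `𝒜` and carrying pulled-back sections to pulled-back
sections — «reduction of points = reduction of tuples». [cite: SerreTate1968, §1] [cite: MumfordFogartyKirwan1994, Ch. 7 §2 Definition 7.2 (p. 129)] -/
theorem exists_iso_fibre_special_along_extendPoint :
    ∃ e : ∀ 𝒜 : AbelianSchemeOver 𝓨.total.left,
        ((𝒜.baseChange (pullback.fst 𝓨.total.hom (specResidueField v))).fibre (𝓨.geomReductionMap x).left).toAbelianVariety ≅
          ((𝒜.baseChange (extendPoint (closureValuationSubring (v.adicCompletion K)) (toClosureValuationSubring v) 𝓨.total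
              (𝓨.modelPointsEquiv.symm x)).left).fibre
            ((geomClosedPointIsoSpecResidueField v).inv.left ≫
              (specRingHomι (closureValuationSubring (v.adicCompletion K)) (toClosureValuationSubring v)
                (IsLocalRing.residue (closureValuationSubring (v.adicCompletion K)))).left)).toAbelianVariety,
      (∀ (𝒜 : AbelianSchemeOver 𝓨.total.left) (τ : 𝒜.Sections),
          AlgPoints.map (e 𝒜).hom.hom.hom.hom
              ((𝒜.baseChange _).restrictPt (𝓨.geomReductionMap x).left (𝒜.sectionBaseChange _ τ)) =
            (𝒜.baseChange _).restrictPt _ (𝒜.sectionBaseChange _ τ)) ∧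
      ∀ (𝒜 ℬ : AbelianSchemeOver 𝓨.total.left) (f : 𝒜.X ⟶ ℬ.X) [IsMonHom f],
        (haveI := isMonHom_baseChangeHom f (pullback.fst 𝓨.total.hom (specResidueField v))
         haveI := isMonHom_baseChangeHom f
           (extendPoint (closureValuationSubring (v.adicCompletion K)) (toClosureValuationSubring v) 𝓨.total
              (𝓨.modelPointsEquiv.symm x)).left
         fibreHom (baseChangeHom f _) (𝓨.geomReductionMap x).left ≫ (e ℬ).hom = (e 𝒜).hom ≫ fibreHom (baseChangeHom f _) _) :=
  exists_iso_fibre_baseChange_of_comp_eq _ _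
    (by rw [𝓨.left_geomReductionMap_comp_fst x, Category.assoc])

end AbelianSchemeOver

end Literature.AlgebraicGeometry.AbelianSchemes

end
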